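import Literature.NumberTheory.EllipticCurves.KrizLi2019.SexticTwistBSDThree
import HarnessLib

/-!
# Kriz–Li 2019, Theorem 9.4 (first assertion) for the sextic twists `E_d : y² = x³ − 432d`: a Heegner field `K` with `d_K` odd and `h₃(d₀ d_K) = 1` EXISTS

HONEST FRAMING (cell `b2b-bsdres`, run/shared/lean/b2b/bsd-rank1-residual/; page 1 everywhere):
prove what is provable now; shrink each hard class to its core with data; no claim beyond stated
classes. The cell deletes the COMBINATION-SHAPED residual classes of the BSD formula in analytic
rank `≤ 1` from PUBLISHED theorems only and TYPES the construction-shaped ones; this is not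
"finishing BSD". This file vendors ONE published theorem as a named fact (`def … : Prop`, nothing
asserted; D-0014), in the vocabulary of the sibling facts
`KrizLi2019.thm1010_bsdThree_overK_sexticTwist` (`SexticTwistBSDThree.lean`, A48) and
`KrizLi2019.cor107_analyticRank_sexticTwist` (`SexticTwistAnalyticRank.lean`): the model
`y² = x³ − 432d` up to `VariableChange ℚ`, Kriz–Li's hypotheses (1) "`d` is a fundamental
discriminant" and (2) "`d ≡ 2 (mod 3)` or `d ≡ 3 (mod 9)`" word for word as there,
`IsImaginaryQuadratic`, `SatisfiesHeegnerHypothesis`, `ThreeClassNumberTrivial`,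
`WeierstrassCurve.conductorNorm ℤ` (= `N(E)`, model-independent).

Why it is vendored (X12 prover owner `b2b-bsdres-x1b`, gen 17; cell lead's ruling CITED-FACTS C149 /
C157 — "AUTHORISED IN ADVANCE for the moment x1b … types a per-POPULATION closing with a binder
`∃ K: Heegner(3N(E_d)) ∧ h₃(d₀d_K) = 1`"; harvest-2 HARVEST §GEN-21 E55 and
`HOME/b2b-bsdres-harvest-2/gen19/Q-RAM3-1-READING.md` §2.2 / §6 (b), whose design this file follows):
the consumer is the FAMILY theorem over `ℚ` for Kriz–Li's sextic twists,
`Summits/BirchSwinnertonDyer/Rank1Residual/X12/SexticTwistFamily.lean` — hypothesis (3b) of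
Theorem 10.10 ("`h₃(d_K d) = 1`" resp. "`h₃(−3 d_K d) = 1`") and the Heegner field `K` itself are
supplied, for EVERY admissible `d`, by this theorem; the seven per-pair records
`Rank1Residual.X12SexticTwist.bsdp_three_cremona<N>_{closed, of_cor107}` chose `K` by hand.

## Citation header (read by this seat from the sources named)

* Authors: Daniel Kriz, Chao Li.
* Title: *Goldfeld's conjecture and congruences between Heegner points*.
* Venue: Forum of Mathematics, Sigma **7** (2019), e15, 80 pp., doi:10.1017/fms.2019.9 (open
  access; bib key `KrizLi2019`; store `paper:doi-10-1017-fms-2019-9`, §9 text chunks p0025–p0028).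
  REFEREED / PUBLISHED. Journal Theorem 9.4 / Remark 9.6 / Theorem 10.6 / Corollary 10.8 =
  `\label{twistpositiveproportion}` (ll. 931–975) / `\label{atleastoneremark}` (l. 1133) /
  `\label{thm:sextic}` (ll. 1407–1430, statement AND proof) / `\label{thm:sexticdensity}`
  (ll. 1444–1453) of the authors' LaTeX source `Eisenstein.tex` of arXiv:1609.06687v3 (held:
  HOME/b2b-bsdres-harvest-2/src/Eisenstein.tex), from which the statements below are copied
  (the journal's LaTeXML text drops the items that begin with a formula; the TeX has them).
* Verbatim (TeX ll. 931–963, Theorem 9.4 = `twistpositiveproportion`; the journal states it for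
  "any elliptic curve `E/ℚ` of conductor `N = N_split N_nonsplit N_add` whose mod `3` Galois
  representation `E[3]` is reducible and `E[3]^{ss} ≅ 𝔽₃(ψ) ⊕ 𝔽₃(ψ⁻¹ω)`", the arXiv text for
  "any `GL₂`-type abelian variety `A/ℚ` of conductor `N = N₊N₋N₀` which has a rational
  `3`-isogeny"):

> **Theorem 9.4.** … Let `d` be the fundamental discriminant corresponding to the quadratic
> character `ψ`. Suppose that
> (1) `ψ(3) ≠ 1` and `(ψ⁻¹ω)(3) ≠ 1`;
> (2) `ℓ ≠ 3, ℓ ∣ N_split` implies `ψ(ℓ) = −1`;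
> (3) `ℓ ≠ 3, ℓ ∣ N_nonsplit` implies `ψ(ℓ) = 1`;
> (4) `ℓ ∣ N_add, ℓ ≡ 1 (mod 3)` implies `ψ(ℓ) = −1` or `0`;
> (5) `ℓ ∣ N_add, ℓ ≡ 2 (mod 3)` implies `ψ(ℓ) = 0`.
> Let `d₀ := d` (`d > 0`); `−3d` (`d < 0, d ≢ 0 (mod 3)`); `−d/3` (`d < 0, d ≡ 0 (mod 3)`) …
> Then a proportion of at least (39) [an explicit positive product] of all imaginary quadratic
> fields `K` have the following properties:
> (1) `d_K` is odd,
> (2) `K` satisfies the Heegner hypothesis with respect to `3N`,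
> (3) `h₃(d₀ d_K) = 1`.
> If furthermore, we impose the assumption … (6) … then … (3) the Heegner point `P ∈ A(K)` is
> non-torsion.

* The hypotheses (1)–(5) FOR `(E_d, ψ_d)` are verified in print, in the proof of Theorem 10.6
  (TeX ll. 1422–1427, verbatim): "By Lemma 10.3 [`E_d[3]^{ss} ≅ 𝔽₃(ψ_d) ⊕ 𝔽₃(ψ_d ω)`, `ψ_d` the
  quadratic character of `ℚ(√d)/ℚ`], we have `E[3]` is reducible with `ψ = ψ_d`. The condition
  that `ψ(3) ≠ 1` and `(ψ⁻¹ω)(3) ≠ 1` is equivalent to that `d ≡ 2 (mod 3)` or `d ≡ 3 (mod 9)`.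
  For `ℓ ≠ 3` and `ℓ ∣ N_add(E_d)`, we have `ℓ ∣ d`, so `ψ_d(ℓ) = 0`." — and (2), (3) are vacuous:
  "Since `E_d` is CM, we know that its conductor `N(E_d) = N_add(E_d)`" (l. 1401). The existence
  consequence is the authors' own, Remark 9.6 (l. 1133): "In particular, for each such `d` there is
  *at least one* `K` …", used in the proof of Corollary 10.8 (ll. 1447–1449): "for each of these `d`
  there is at least one imaginary quadratic field `K` satisfying the Heegner hypothesis with respect
  to `3d` and such that `h₃(d_K d) = 1` if `d > 0` and `h₃(−3 d_K d) = 1` if `d < 0`."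
* The engine under Theorem 9.4 is Nakagawa–Horie, Proc. AMS 104 (1988), Thm. 1 (= Kriz–Li
  Thm. 9.2) with the trivial estimate of Taya, Proc. AMS 128 (2000) (= Kriz–Li Prop. 9.3) — all
  refereed and in print (harvest-2, Q-RAM3-1-READING §§1–2; NOT Wiles 2015 / Beckwith 2017, which
  are `ℓ ≥ 5` / `ℓ > 3`).

## Hypotheses, enumerated (word for word → tree vocabulary)

1. `E = E_d : y² = x³ − 432d` — `W : WeierstrassCurve ℚ`, elliptic, `ℚ`-isomorphic to the
   displayed model: `∃ C : VariableChange ℚ, C • W = ⟨0, 0, 0, 0, −432 d⟩` (as in A48); `N` its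
   conductor — `W.conductorNorm ℤ` (model-independent, `conductorNorm_smul_rat`).
2. "`d` is a fundamental discriminant" — spelled exactly as in A48 / Cor. 10.7.
3. Theorem 9.4 (1)–(5) for `(E_d, ψ_d)` ⟸ "`d ≡ 2 (mod 3)` or `d ≡ 3 (mod 9)`" (proof of Thm. 10.6)
   — `d % 3 = 2 ∨ d % 9 = 3`, exactly hypothesis (2) of `cor107_analyticRank_sexticTwist`.
4. Conclusion, EXISTENCE form (weaker than the printed positive proportion): there is a number
   field `K` with `IsImaginaryQuadratic K` and
   (1) `Odd (NumberField.discr K)`;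
   (2) `SatisfiesHeegnerHypothesis (3 * W.conductorNorm ℤ) K` ("with respect to `3N`");
   (3) `h₃(d₀ d_K) = 1`, rendered in the shape hypothesis (3) of Theorem 10.10 consumes:
   `d > 0`: `ThreeClassNumberTrivial (d_K * d)` (`d₀ d_K = d d_K`); `d < 0`:
   `ThreeClassNumberTrivial (−3 * d_K * d)` — for `3 ∤ d` this is `d₀ d_K = −3 d d_K` literally, and
   for `3 ∣ d` the printed `d₀ d_K = −d d_K / 3` generates THE SAME quadratic field
   (`−3 d d_K = 9 · (−d d_K/3)`; `ThreeClassNumberTrivial D` only depends on `ℚ(√D)`), which is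
   also how Corollary 10.8's proof sentence reads the conclusion ("`h₃(−3 d_K d) = 1` if `d < 0`").
   Not transcribed: the proportion (39), the second assertion (non-torsion Heegner point under (6)),
   and the general `E` / `A` of Theorem 9.4 (only the sextic-twist instance has a consumer; the
   tree has no `ψ`-of-a-`3`-isogeny vocabulary to state (1)–(5) for a general curve).

No `_holds` is to be expected soon (Davenport–Heilbronn / Nakagawa–Horie densities of `3`-class
numbers in residue classes: not in Mathlib). D-0026: exactly ONE new named fact, filed together with
its consumer. Registry: HOME/CITED-FACTS.md (lit seat, page-audit at registration).

## References
* [KrizLi2019] D. Kriz, C. Li, *Goldfeld's conjecture and congruences between Heegner points*,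
  Forum Math. Sigma 7 (2019) e15, Thm. 9.4, Rem. 9.6, Thm. 10.6 (proof), Cor. 10.8 (proof);
  = arXiv:1609.06687v3 (`twistpositiveproportion`, `atleastoneremark`, `thm:sextic`,
  `thm:sexticdensity`).
* J. Nakagawa, K. Horie, *Elliptic curves with no rational points*, Proc. AMS 104 (1988), Thm. 1;
  H. Taya, Proc. AMS 128 (2000) (the density engine, as cited by Kriz–Li Thm. 9.2 / Prop. 9.3).
* HOME/b2b-bsdres-harvest-2/gen19/Q-RAM3-1-READING.md (the reading this file transcribes);
  HOME/b2b-bsdres-x1b/X12-ROUTE.md §21 (the consumer).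
-/

noncomputable section

open scoped Classical

open WeierstrassCurve NumberField Literature.NumberTheory.EllipticCurves

namespace Literature.NumberTheory.EllipticCurves.KrizLi2019

/-- **Kriz–Li, Forum Math. Sigma 7 (2019) e15, Theorem 9.4 (first assertion), for the sextic
twists `E_d : y² = x³ − 432d`** (hypotheses (1)–(5) of Theorem 9.4 for `(E_d, ψ_d)` verified in
print in the proof of Theorem 10.6; existence consequence = Remark 9.6 / proof of Corollary 10.8):
for every fundamental discriminant `d` with `d ≡ 2 (mod 3)` or `d ≡ 3 (mod 9)` and every elliptic
curve `E ≅_ℚ E_d` of conductor `N`, "a proportion of at least (39) of all imaginary quadratic fields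
`K` have the following properties: (1) `d_K` is odd, (2) `K` satisfies the Heegner hypothesis with
respect to `3N`, (3) `h₃(d₀ d_K) = 1`", `d₀ = d` (`d > 0`), `−3d` (`d < 0`, `3 ∤ d`), `−d/3`
(`d < 0`, `3 ∣ d`) — transcribed in EXISTENCE form (weaker than print): such a `K` exists. Tree
rendering (module docstring items 1–4): `W` any `ℚ`-model of `E_d`, `N = W.conductorNorm ℤ`,
(3) as `ThreeClassNumberTrivial (d_K·d)` for `d > 0` and `ThreeClassNumberTrivial (−3·d_K·d)` for
`d < 0` (the same quadratic field as `ℚ(√(d₀ d_K))` in both sub-cases), i.e. literally hypothesis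
(3b) of `thm1010_bsdThree_overK_sexticTwist`. PUBLISHED.
[cite: KrizLi2019, Thm. 9.4 (first assertion) with the proof of Thm. 10.6 and Rem. 9.6 / proof of Cor. 10.8] -/
def thm94_exists_heegnerField_h3_eq_one : Prop :=
  ∀ (d : ℤ) (W : WeierstrassCurve ℚ) [W.IsElliptic],
    -- `W ≅_ℚ E_d : y² = x³ − 432 d`
    (∃ C : VariableChange ℚ, C • W = ({ a₁ := 0, a₂ := 0, a₃ := 0, a₄ := 0, a₆ := -432 * d } :
      WeierstrassCurve ℚ)) →
    -- (1) `d` is a fundamental discriminant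
    ((d % 4 = 1 ∧ Squarefree d ∧ d ≠ 1) ∨
      (4 ∣ d ∧ (d / 4 % 4 = 2 ∨ d / 4 % 4 = 3) ∧ Squarefree (d / 4))) →
    -- Theorem 9.4 (1)–(5) for `(E_d, ψ_d)`: "`d ≡ 2 (mod 3)` or `d ≡ 3 (mod 9)`" (proof of Thm. 10.6)
    (d % 3 = 2 ∨ d % 9 = 3) →
    ∃ (K : Type) (_ : Field K) (_ : NumberField K),
      IsImaginaryQuadratic K ∧
        -- (1) `d_K` is odd
        Odd (NumberField.discr K) ∧
        -- (2) the Heegner hypothesis with respect to `3N`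
        SatisfiesHeegnerHypothesis (3 * W.conductorNorm ℤ) K ∧
        -- (3) `h₃(d₀ d_K) = 1`
        (0 < d → ThreeClassNumberTrivial (NumberField.discr K * d)) ∧
        (d < 0 → ThreeClassNumberTrivial (-3 * NumberField.discr K * d))

/-- Unpacking for a fixed admissible `d` and model `W`: the Heegner field of Theorem 9.4 with its
three properties, in the binder shape of `thm1010_bsdThree_overK_sexticTwist` (3b).
[cite: KrizLi2019, Thm. 9.4 (first assertion)] -/
theorem exists_heegnerField_of_thm94 (h94 : thm94_exists_heegnerField_h3_eq_one) (d : ℤ)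
    (W : WeierstrassCurve ℚ) [W.IsElliptic]
    (hW : ∃ C : VariableChange ℚ, C • W = ({ a₁ := 0, a₂ := 0, a₃ := 0, a₄ := 0, a₆ := -432 * d } :
      WeierstrassCurve ℚ))
    (h1 : (d % 4 = 1 ∧ Squarefree d ∧ d ≠ 1) ∨
      (4 ∣ d ∧ (d / 4 % 4 = 2 ∨ d / 4 % 4 = 3) ∧ Squarefree (d / 4)))
    (h2 : d % 3 = 2 ∨ d % 9 = 3) :
    ∃ (K : Type) (_ : Field K) (_ : NumberField K),
      IsImaginaryQuadratic K ∧ Odd (NumberField.discr K) ∧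
        SatisfiesHeegnerHypothesis (3 * W.conductorNorm ℤ) K ∧
        (0 < d → ThreeClassNumberTrivial (NumberField.discr K * d)) ∧
        (d < 0 → ThreeClassNumberTrivial (-3 * NumberField.discr K * d)) :=
  h94 d W hW h1 h2

end Literature.NumberTheory.EllipticCurves.KrizLi2019

end
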